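import Mathlib
import Summits.Ventures.HodgeRepro.OcticCMPointGaloisRing16Prim

/-!
# OcticCMPointGaloisRing16Ideal — the ideal `I = 𝔮²/𝔮⁴ = 4 GR(16, 4)` of the stationary phase

Blind re-derivation cell `pub-hodge-repro`, seat night-2 (gen 5).  Target tree path
`lean/Summits/Ventures/HodgeRepro/OcticCMPointGaloisRing16Ideal.lean`.  On `GR(16, 4) = 𝒪/𝔮⁴` with the primitive
`σ`-odd `ψ̃_δ` of `OcticCMPointGaloisRing16Prim.lean`, the ideal `I = 4 GR(16, 4) = 𝔮²/𝔮⁴` (`I4`) has exactly the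
properties the even-conductor theorem `GaussSumEvenConductor.LocalChar.eps_eq_of_conjDual` needs:

* `I · I = 0` (`I4_sq`: `16 = 0`) and `σ(I) ⊆ I` (`conj_mem_I4`);
* **the `ψ̃_δ`-annihilator of `I` is `I`** (`psiAnn_I4_iff`): `ψ̃_δ(x · 4b) = 1` for all `b` forces `4x = 0` by
  primitivity, and `4x = 0` means every coordinate of `x` lies in `4ℤ/16` (`red4`, the coordinates mod `4`), i.e.
  `x ∈ 4GR`;
* **`|I| = 256 = |GR(16, 4)|^{1/2}`** (`card_I4`: multiplication by `4` has kernel and range `I`, so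
  `|GR| = |GR/I| · |I| = |I|²`); hence `κ = 1/256` (`kappa_mul_card`).

**What this is not.**  The root numbers are in `OcticCMPointGaloisRing16Sign.lean`.  Nothing here says anything
about the status of the Hodge conjecture for CM abelian varieties, which is NOT proved.
-/

set_option autoImplicit false

noncomputable section

open Polynomial Classical

namespace Summit.Ventures.HodgeRepro.PeriodCloser

namespace GaloisRing16

open GaussSumStability

/-- **The ideal `I = 4 GR(16, 4) = 𝔮²/𝔮⁴`** of the stationary phase. -/
def I4 : Ideal GR164 := Ideal.span {(4 : GR164)}

/-- `y ∈ I ↔ y = 4b`. -/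
theorem mem_I4_iff (y : GR164) : y ∈ I4 ↔ ∃ b, y = 4 * b := by
  rw [I4, Ideal.mem_span_singleton']
  constructor
  · rintro ⟨b, hb⟩
    exact ⟨b, by rw [← hb, mul_comm]⟩
  · rintro ⟨b, hb⟩
    exact ⟨b, by rw [hb, mul_comm]⟩

/-- **`I · I = 0`** (`16 = 0`). -/
theorem I4_sq (z : GR164) (hz : z ∈ I4) (z' : GR164) (hz' : z' ∈ I4) : z * z' = 0 := by
  obtain ⟨b, rfl⟩ := (mem_I4_iff z).1 hz
  obtain ⟨b', rfl⟩ := (mem_I4_iff z').1 hz'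
  have h16 := sixteen_eq_zero
  linear_combination (b * b') * h16

/-- `σ(I) ⊆ I`. -/
theorem conj_mem_I4 (z : GR164) (hz : z ∈ I4) : conjGR z ∈ I4 := by
  obtain ⟨b, rfl⟩ := (mem_I4_iff z).1 hz
  rw [map_mul, map_ofNat]
  exact (mem_I4_iff _).2 ⟨conjGR b, rfl⟩

/-- The reduction `ℤ/16 → ℤ/4`. -/
def c4 : ZMod 16 →+* ZMod 4 := ZMod.castHom (by norm_num : 4 ∣ 16) (ZMod 4)

/-- The residue of `y` mod `4GR`: the coordinates mod `4`. -/
def red4 (y : GR164) : Fin 4 → ZMod 4 := fun i => c4 (b4.repr y i)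

/-- `red4` is additive. -/
theorem red4_add (y z : GR164) : red4 (y + z) = red4 y + red4 z := by
  funext i; simp [red4, map_add]

/-- `red4 (−y) = −red4 y`. -/
theorem red4_neg (y : GR164) : red4 (-y) = -red4 y := by
  funext i; simp [red4, map_neg]

/-- `c4 c = 0 → c = 4 d`. -/
theorem eq_four_mul_of_c4_eq_zero (c : ZMod 16) (h : c4 c = 0) : ∃ d : ZMod 16, c = 4 * d := by
  revert c; decide

/-- Residue `0` means `y = 4b`. -/
theorem eq_four_mul_of_red4_eq_zero {y : GR164} (h : red4 y = 0) : ∃ b : GR164, y = 4 * b := by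
  choose d hd using fun i => eq_four_mul_of_c4_eq_zero (b4.repr y i) (congrFun h i)
  refine ⟨∑ i, d i • b4 i, ?_⟩
  conv_lhs => rw [← b4.sum_repr y]
  rw [Finset.mul_sum]
  refine Finset.sum_congr rfl fun i _ => ?_
  rw [hd i, show (4 : GR164) * (d i • b4 i) = ((4 : ZMod 16) * d i) • b4 i by
    rw [mul_smul, Algebra.smul_def (4 : ZMod 16), map_ofNat]]

/-- `4y = 0 → red4 y = 0`. -/
theorem red4_eq_zero_of_four_mul_eq_zero {y : GR164} (h : 4 * y = 0) : red4 y = 0 := by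
  funext i
  have h4 : (4 : GR164) * y = (4 : ZMod 16) • y := by rw [Algebra.smul_def, map_ofNat]
  have h' : b4.repr ((4 : ZMod 16) • y) i = 0 := by
    rw [← h4, h, map_zero]
    rfl
  rw [map_smul, Finsupp.coe_smul, Pi.smul_apply, smul_eq_mul] at h'
  have hc : ∀ c : ZMod 16, 4 * c = 0 → c4 c = 0 := by decide
  exact hc _ h'

/-- `red4 y = 0 → 4y = 0`. -/
theorem four_mul_eq_zero_of_red4_eq_zero {y : GR164} (h : red4 y = 0) : 4 * y = 0 := by
  obtain ⟨b, rfl⟩ := eq_four_mul_of_red4_eq_zero h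
  have h16 := sixteen_eq_zero
  linear_combination b * h16

/-- `y ∈ I ↔ red4 y = 0`. -/
theorem mem_I4_iff_red4 (y : GR164) : y ∈ I4 ↔ red4 y = 0 := by
  rw [mem_I4_iff]
  constructor
  · rintro ⟨b, rfl⟩
    apply red4_eq_zero_of_four_mul_eq_zero
    have h16 := sixteen_eq_zero
    linear_combination b * h16
  · exact eq_four_mul_of_red4_eq_zero

/-- `y − z ∈ I ↔ red4 y = red4 z`. -/
theorem sub_mem_I4_iff (y z : GR164) : y - z ∈ I4 ↔ red4 y = red4 z := by
  rw [mem_I4_iff_red4, sub_eq_add_neg, red4_add, red4_neg]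
  constructor
  · intro h
    exact sub_eq_zero.1 (by rw [sub_eq_add_neg]; exact h)
  · intro h
    rw [h, add_neg_cancel]

/-- **The `ψ̃_δ`-annihilator of `I` is `I`**: `ψ̃_δ(x · 4b) = 1` for all `b` forces `4x = 0` (primitivity), i.e.
`x ∈ 4GR`. -/
theorem psiAnn_I4_iff (x : GR164) : PsiAnn psiTildeGR16 I4 x ↔ x ∈ I4 := by
  constructor
  · intro h
    have h4 : 4 * x = 0 := by
      by_contra hne
      apply psiTildeGR16_isPrimitive hne
      ext b
      rw [AddChar.mulShift_apply, AddChar.one_apply]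
      have := h (4 * b) ((mem_I4_iff _).2 ⟨b, rfl⟩)
      rwa [show x * (4 * b) = 4 * x * b by ring] at this
    exact (mem_I4_iff_red4 x).2 (red4_eq_zero_of_four_mul_eq_zero h4)
  · intro hx z hz
    rw [I4_sq x hx z hz, AddChar.map_zero_eq_one]

/-! ### `|I| = 256` -/

/-- Multiplication by `4` as an additive map. -/
def mul4 : GR164 →+ GR164 := AddMonoidHom.mulLeft (4 : GR164)

/-- `mul4 y = 4y`. -/
theorem mul4_apply (y : GR164) : mul4 y = 4 * y := rfl

/-- The range of `mul4` is `I`. -/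
theorem mul4_range : mul4.range = I4.toAddSubgroup := by
  ext y
  rw [AddMonoidHom.mem_range, Submodule.mem_toAddSubgroup, mem_I4_iff]
  exact ⟨fun ⟨b, hb⟩ => ⟨b, hb.symm⟩, fun ⟨b, hb⟩ => ⟨b, hb.symm⟩⟩

/-- The kernel of `mul4` is `I`. -/
theorem mul4_ker : mul4.ker = I4.toAddSubgroup := by
  ext y
  rw [AddMonoidHom.mem_ker, Submodule.mem_toAddSubgroup, mem_I4_iff_red4, mul4_apply]
  exact ⟨red4_eq_zero_of_four_mul_eq_zero, four_mul_eq_zero_of_red4_eq_zero⟩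

/-- **`|I| = 256`**: `|GR(16, 4)| = |GR/ker| · |ker| = |I|²`. -/
theorem natCard_I4 : Nat.card I4 = 256 := by
  have h1 := AddSubgroup.card_eq_card_quotient_mul_card_addSubgroup mul4.ker
  have h2 : Nat.card (GR164 ⧸ mul4.ker) = Nat.card mul4.range :=
    Nat.card_congr (QuotientAddGroup.quotientKerEquivRange mul4).toEquiv
  rw [h2, mul4_range, mul4_ker] at h1
  have h3 : Nat.card GR164 = 256 * 256 := by rw [Nat.card_eq_fintype_card, card_GR164]
  have h4 : Nat.card I4.toAddSubgroup = Nat.card I4 :=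
    Nat.card_congr (Equiv.subtypeEquivRight fun x => Submodule.mem_toAddSubgroup I4)
  rw [h4, h3] at h1
  exact Nat.mul_self_inj.1 h1.symm

/-- `|I| = 256 = |GR(16, 4)|^{1/2}`. -/
theorem card_I4 : Fintype.card I4 = 256 := by
  rw [← Nat.card_eq_fintype_card, natCard_I4]

/-- `κ = 1/256` satisfies `κ |I| = 1`. -/
theorem kappa_mul_card : (1 / 256 : ℂ) * (Fintype.card I4 : ℂ) = 1 := by
  rw [card_I4]
  norm_num

end GaloisRing16

end Summit.Ventures.HodgeRepro.PeriodCloser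

end
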